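import Mathlib
import HarnessLib
import Literature.MathematicalPhysics.QuantumLattice.FermiRG.BGM2003Sectors
import Summits.HubbardSuperconductivity.HubbardSuperconductivity.Theorems.KLProgrammeAbsUmklappClassFibre

/-!
# Route `KLProgramme` — K3 engine (stmt-HubbardSuperconductivity-20437), stub (b) (ℓ)/(I2)–(I3), located item «ABS-UMK-COUNT»:
# the FIBRE BOUND with an arbitrary side predicate (towards PRESCRIBED sets of legs, exponent `L − |E| − 2`)

Cell gate-hubbard-kl, seat p4 g15.  `card_classFibre_le` (…ClassFibre) carries the conjunct «`ω_{i₁} = ω₁` and the free legs are pairwise within pair angle `Φ₀`»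
through its proof without using it.  For the PRESCRIBED-SET version of «ABS-UMK-COUNT» (a set `E` of legs with prescribed labels, the remaining legs free —
the shape E1's (I2) cells with `|E| ≥ 2` known legs need, cf. `BGM2003.count_target_wide_prescribed`) the same fibre bound is needed with a different side
condition; this file states it ONCE for an arbitrary predicate `Pre`:

* **`card_classFibre_le_pred`** — fibre of the kept-legs projection `≤ T_bound`, for the class `{ω : Pre ω ∧ cone(a,b,c; θ_s + σ) ∧ ∃ k ∈ sectors, Σ k = R}`.

Everything is PROVED (the proof of `card_classFibre_le` verbatim); no definitions, no named facts. [cite: BenfattoGiulianiMastropietro2003, §7.1 Lemma 7.3 (A1.13) and §7.4 p.28]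
-/

noncomputable section

open Real Set
open Literature.MathematicalPhysics.QuantumLattice Literature.MathematicalPhysics.QuantumLattice.FermiRG
open Literature.MathematicalPhysics.QuantumLattice.FermiRG.BGM2003
open Summit.HubbardSuperconductivity.HubbardSuperconductivity.Theorems.ThinLevelSet
open Summit.HubbardSuperconductivity.HubbardSuperconductivity.Theorems

namespace Summit.HubbardSuperconductivity.HubbardSuperconductivity.Theorems.AbsUmklappCount

set_option linter.dupNamespace false -- summit = problem name (single-conjunct summit), D-0017

open Classical in
/-- **The fibre bound, arbitrary side predicate.**  As `card_classFibre_le`, with the conjunct «anchored at `ω₁` and narrow» replaced by an ARBITRARY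
predicate `Pre` on strings (e.g. «agrees with a prescribed string on a set `E` of legs, free legs pairwise narrow»): in the class of target strings
satisfying `Pre` with kept legs `a, b, c` within torus distance `2Φ₀` of `θ⋆ = θ_{n′,ω_s} + σ`, the strings with prescribed values `ρ` off the kept legs
number at most `T_bound` (the proof never inspects `Pre`). [cite: BenfattoGiulianiMastropietro2003, §7.4 p.28 (L33–52)] -/
theorem card_classFibre_le_pred {ε : (Fin 2 → ℝ) → ℝ} {μ e₀ : ℝ} {u : ℝ → ℝ → ℝ} (hD : DispersionHyp ε μ e₀ u) {c₃ : ℝ} (hc₃ : 0 < c₃)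
    (h73 : ∀ (n ω : ℕ), ω < sectorCount n → ∀ p ∈ sSector u e₀ n ω,
      ∃ k₁ k₂ : ℝ,
        p = fermiPoint u (sectorCenter n ω) + k₁ • unitNormal u (sectorCenter n ω) 0 +
              k₂ • unitTangent u (sectorCenter n ω) 0 ∧
        |k₁| ≤ c₃ * (4 : ℝ) ^ (-(n : ℤ)) ∧ |k₂| ≤ c₃ * (2 : ℝ) ^ (-(n : ℤ)) ∧
        |fderiv ℝ ε p (unitTangent u (sectorCenter n ω) 0)| ≤ c₃ * (2 : ℝ) ^ (-(n : ℤ)))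
    {s₁ Φ cf Af Bf M₁ : ℝ} (hs₁ : 0 < s₁) (hM₁ : 0 ≤ M₁) (hΦ : 0 < Φ) (hcf : 0 < cf) (hcfA : cf ≤ Af) (hBf : 0 ≤ Bf)
    (hchart : ∀ θs : ℝ, ∃ f f' f'' : ℝ → ℝ, Measurable f ∧
        (∀ φ ∈ Icc (-Φ) Φ,
          f ((fermiPoint u (θs + φ) - fermiPoint u θs) ⬝ᵥ tdir θs) = -((fermiPoint u (θs + φ) - fermiPoint u θs) ⬝ᵥ dir θs)) ∧
        (∀ y ∈ Icc (-(s₁ / 4 * Φ)) (s₁ / 4 * Φ), HasDerivAt f (f' y) y ∧ HasDerivAt f' (f'' y) y ∧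
          cf ≤ f'' y ∧ f'' y ≤ Af ∧ |f' y| ≤ Bf) ∧
        (∀ φ ∈ Icc (-Φ) Φ, ∀ φ' ∈ Icc (-Φ) Φ,
          s₁ / 2 * |φ - φ'| ≤ |(fermiPoint u (θs + φ) - fermiPoint u θs) ⬝ᵥ tdir θs - (fermiPoint u (θs + φ') - fermiPoint u θs) ⬝ᵥ tdir θs| ∧
          |(fermiPoint u (θs + φ) - fermiPoint u θs) ⬝ᵥ tdir θs - (fermiPoint u (θs + φ') - fermiPoint u θs) ⬝ᵥ tdir θs| ≤ M₁ * |φ - φ'|) ∧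
        (fermiPoint u (θs + 0) - fermiPoint u θs) ⬝ᵥ tdir θs = 0)
    {n' L : ℕ} (Pre : (Fin L → Fin (sectorCount n')) → Prop) (s a b c : Fin L) (hsa : s ≠ a) (hsb : s ≠ b) (hsc : s ≠ c)
    (hab : a ≠ b) (hac : a ≠ c) (hbc : b ≠ c) (R : Fin 2 → ℝ) {Φ₀ : ℝ} (hΦ₀ : 0 ≤ Φ₀) (h2Φ₀ : 2 * Φ₀ ≤ Φ) (σ : ℝ)
    (hreg : 6 * (M₁ * (2 * Φ₀)) + 3 * (L * (4 * c₃ * (2 : ℝ) ^ (-(n' : ℤ)))) + 2 * (s₁ / 2 * sectorWidth n') ≤ s₁ / 4 * Φ)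
    (ρ : Fin L → Fin (sectorCount n')) :
    ((((Finset.univ : Finset (Fin L → Fin (sectorCount n'))).filter fun ω =>
        Pre ω ∧
        (∀ x ∈ ({a, b, c} : Finset (Fin L)), FermiRG.torusDist (sectorCenter n' (ω x) - (sectorCenter n' (ω s) + σ)) ≤ 2 * Φ₀) ∧
        ∃ k : Fin L → (Fin 2 → ℝ), (∀ i, k i ∈ sSector u e₀ n' (ω i : ℕ)) ∧ ∑ i, k i = R).filter
        fun ω => Function.update (Function.update (Function.update ω a ⟨0, sectorCount_pos n'⟩) b ⟨0, sectorCount_pos n'⟩) c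
          ⟨0, sectorCount_pos n'⟩ = ρ).card : ℝ) ≤
      (2 * (L * (4 * c₃ * (2 : ℝ) ^ (-(n' : ℤ)))) / (s₁ / 2 * sectorWidth n') + 1) *
        (960 * Af * (2 * (L * (4 * c₃ * (2 : ℝ) ^ (-(n' : ℤ))) + Bf * (L * (4 * c₃ * (2 : ℝ) ^ (-(n' : ℤ))))) +
          (4 * Bf + 1) * (s₁ / 2 * sectorWidth n')) / cf ^ 2 / (s₁ / 2 * sectorWidth n') ^ 2) := by
  set z : Fin (sectorCount n') := ⟨0, sectorCount_pos n'⟩ with hz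
  set δ : ℝ := 4 * c₃ * (2 : ℝ) ^ (-(n' : ℤ)) with hδ
  have hδ0 : 0 ≤ δ := by rw [hδ]; positivity
  set θs : ℝ := sectorCenter n' (ρ s) + σ with hθs
  obtain ⟨f, f', f'', hfm, hval, hder, hlip, hU0⟩ := hchart θs
  -- the label-triple set of `card_labelTriples_le` at `θ⋆`, with the context vector `Q`
  set Q : Fin 2 → ℝ := R - ∑ i ∈ Finset.univ \ {a, b, c}, fermiPoint u (sectorCenter n' (ρ i)) - (3 : ℝ) • fermiPoint u θs with hQ
  set T := (Finset.univ : Finset ((Fin (sectorCount n') × Fin (sectorCount n')) × Fin (sectorCount n'))).filter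
        fun t => FermiRG.torusDist (sectorCenter n' t.1.1 - θs) ≤ 2 * Φ₀ ∧ FermiRG.torusDist (sectorCenter n' t.1.2 - θs) ≤ 2 * Φ₀ ∧
          FermiRG.torusDist (sectorCenter n' t.2 - θs) ≤ 2 * Φ₀ ∧
          |(fermiPoint u (θs + (sectorCenter n' t.1.1 - θs - round ((2 * π)⁻¹ * (sectorCenter n' t.1.1 - θs)) * (2 * π))) -
                fermiPoint u θs) ⬝ᵥ tdir θs +
              (fermiPoint u (θs + (sectorCenter n' t.1.2 - θs - round ((2 * π)⁻¹ * (sectorCenter n' t.1.2 - θs)) * (2 * π))) -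
                fermiPoint u θs) ⬝ᵥ tdir θs +
              (fermiPoint u (θs + (sectorCenter n' t.2 - θs - round ((2 * π)⁻¹ * (sectorCenter n' t.2 - θs)) * (2 * π))) -
                fermiPoint u θs) ⬝ᵥ tdir θs - Q ⬝ᵥ tdir θs| ≤ L * δ ∧
          |f ((fermiPoint u (θs + (sectorCenter n' t.1.1 - θs - round ((2 * π)⁻¹ * (sectorCenter n' t.1.1 - θs)) * (2 * π))) -
                fermiPoint u θs) ⬝ᵥ tdir θs) +
              f ((fermiPoint u (θs + (sectorCenter n' t.1.2 - θs - round ((2 * π)⁻¹ * (sectorCenter n' t.1.2 - θs)) * (2 * π))) -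
                fermiPoint u θs) ⬝ᵥ tdir θs) +
              f ((fermiPoint u (θs + (sectorCenter n' t.2 - θs - round ((2 * π)⁻¹ * (sectorCenter n' t.2 - θs)) * (2 * π))) -
                fermiPoint u θs) ⬝ᵥ tdir θs) - -(Q ⬝ᵥ dir θs)| ≤ L * δ with hT
  have hTcard : (T.card : ℝ) ≤ (2 * (L * δ) / (s₁ / 2 * sectorWidth n') + 1) *
      (960 * Af * (2 * (L * δ + Bf * (L * δ)) + (4 * Bf + 1) * (s₁ / 2 * sectorWidth n')) / cf ^ 2 / (s₁ / 2 * sectorWidth n') ^ 2) :=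
    card_labelTriples_le (U := fun φ => (fermiPoint u (θs + φ) - fermiPoint u θs) ⬝ᵥ tdir θs) hfm
      (half_pos hs₁) hM₁ hΦ.le (by positivity) h2Φ₀ (fun φ hφ φ' hφ' => (hlip φ hφ φ' hφ').1)
      (fun φ hφ φ' hφ' => (hlip φ hφ φ' hφ').2) hU0 hcf hcfA hBf (by positivity) (by positivity) n' hreg
      (fun y hy => (hder y hy).1) (fun y hy => (hder y hy).2.1) (fun y hy => (hder y hy).2.2.1)
      (fun y hy => (hder y hy).2.2.2.1) (fun y hy => (hder y hy).2.2.2.2) θs (Q ⬝ᵥ tdir θs) (-(Q ⬝ᵥ dir θs))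
  -- the fibre and its injection into `T`
  set Fib := (((Finset.univ : Finset (Fin L → Fin (sectorCount n'))).filter fun ω =>
        Pre ω ∧
        (∀ x ∈ ({a, b, c} : Finset (Fin L)), FermiRG.torusDist (sectorCenter n' (ω x) - (sectorCenter n' (ω s) + σ)) ≤ 2 * Φ₀) ∧
        ∃ k : Fin L → (Fin 2 → ℝ), (∀ i, k i ∈ sSector u e₀ n' (ω i : ℕ)) ∧ ∑ i, k i = R).filter
        fun ω => Function.update (Function.update (Function.update ω a z) b z) c z = ρ) with hFib
  set e : (Fin L → Fin (sectorCount n')) → (Fin (sectorCount n') × Fin (sectorCount n')) × Fin (sectorCount n') := fun ω => ((ω a, ω b), ω c) with he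
  -- off the kept legs a fibre element agrees with `ρ`
  have hoff : ∀ ω : Fin L → Fin (sectorCount n'), Function.update (Function.update (Function.update ω a z) b z) c z = ρ →
      ∀ i, i ≠ a → i ≠ b → i ≠ c → ω i = ρ i := by
    intro ω hω i hia' hib' hic'
    have h1 := congrFun hω i
    rw [Function.update_of_ne hic', Function.update_of_ne hib', Function.update_of_ne hia'] at h1
    exact h1
  have hmemFib : ∀ ω ∈ Fib, (Pre ω ∧
      (∀ x ∈ ({a, b, c} : Finset (Fin L)), FermiRG.torusDist (sectorCenter n' (ω x) - (sectorCenter n' (ω s) + σ)) ≤ 2 * Φ₀) ∧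
      ∃ k : Fin L → (Fin 2 → ℝ), (∀ i, k i ∈ sSector u e₀ n' (ω i : ℕ)) ∧ ∑ i, k i = R) ∧
      Function.update (Function.update (Function.update ω a z) b z) c z = ρ := by
    intro ω hω
    rw [hFib, Finset.mem_filter, Finset.mem_filter] at hω
    exact ⟨hω.1.2, hω.2⟩
  have hinj : Set.InjOn e Fib := by
    intro ω hω ω' hω' hee
    have h1 := (hmemFib ω (by simpa using hω)).2
    have h2 := (hmemFib ω' (by simpa using hω')).2
    rw [he] at hee
    simp only [Prod.mk.injEq] at hee
    obtain ⟨⟨ea, eb⟩, ec⟩ := hee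
    funext i
    by_cases hia' : i = a
    · rw [hia']; exact ea
    by_cases hib' : i = b
    · rw [hib']; exact eb
    by_cases hic' : i = c
    · rw [hic']; exact ec
    rw [hoff ω h1 i hia' hib' hic', hoff ω' h2 i hia' hib' hic']
  have hmaps : Set.MapsTo e Fib T := by
    intro ω hω
    obtain ⟨⟨-, hcone, k, hk, hsum⟩, hupd⟩ := hmemFib ω (by simpa using hω)
    have hωs : ω s = ρ s := hoff ω hupd s hsa hsb hsc
    have hθs' : sectorCenter n' (ω s) + σ = θs := by rw [hθs, hωs]
    have hca : FermiRG.torusDist (sectorCenter n' (ω a) - θs) ≤ 2 * Φ₀ := by rw [← hθs']; exact hcone a (by simp)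
    have hcb : FermiRG.torusDist (sectorCenter n' (ω b) - θs) ≤ 2 * Φ₀ := by rw [← hθs']; exact hcone b (by simp)
    have hcc : FermiRG.torusDist (sectorCenter n' (ω c) - θs) ≤ 2 * Φ₀ := by rw [← hθs']; exact hcone c (by simp)
    -- sector boxes
    have hbox := fun i => h73 n' (ω i) (ω i).isLt (k i) (hk i)
    choose k₁ k₂ hdec hk₁ hk₂ _hk₃ using hbox
    set d : Fin L → (Fin 2 → ℝ) := fun i => k₁ i • unitNormal u (sectorCenter n' (ω i)) 0 + k₂ i • unitTangent u (sectorCenter n' (ω i)) 0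
      with hd
    have hkd : ∀ i, k i = fermiPoint u (sectorCenter n' (ω i)) + d i := fun i => by rw [hdec i, hd]; simp only; rw [add_assoc]
    have hkk : ∀ i, 2 * (|k₁ i| + |k₂ i|) ≤ δ := by
      intro i
      have h4 := PerturbedFermiCurve.four_zpow_neg_le_two_zpow_neg n'
      have h1 : |k₁ i| ≤ c₃ * (2 : ℝ) ^ (-(n' : ℤ)) := (hk₁ i).trans (mul_le_mul_of_nonneg_left h4 hc₃.le)
      rw [hδ]; linarith [hk₂ i]
    have hdt : ∀ i, |d i ⬝ᵥ tdir θs| ≤ δ := fun i =>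
      (abs_boxDisplacement_dotProduct_le u _ _ _ (abs_tdir_le_one θs)).trans (hkk i)
    have hdn : ∀ i, |d i ⬝ᵥ dir θs| ≤ δ := fun i =>
      (abs_boxDisplacement_dotProduct_le u _ _ _ (abs_dir_le_one θs)).trans (hkk i)
    -- the kept legs in the chart
    set φ : Fin L → ℝ := fun x => sectorCenter n' (ω x) - θs - round ((2 * π)⁻¹ * (sectorCenter n' (ω x) - θs)) * (2 * π) with hφ
    set j : Fin L → ℤ := fun x => round ((2 * π)⁻¹ * (sectorCenter n' (ω x) - θs)) with hj
    have hθ : ∀ x ∈ ({a, b, c} : Finset (Fin L)), sectorCenter n' (ω x) = θs + φ x + j x * (2 * π) := by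
      intro x _; rw [hφ, hj]; simp only; ring
    have hφΦ : ∀ x ∈ ({a, b, c} : Finset (Fin L)), φ x ∈ Icc (-Φ) Φ := by
      intro x hx
      have hcx : FermiRG.torusDist (sectorCenter n' (ω x) - θs) ≤ 2 * Φ₀ := by rw [← hθs']; exact hcone x hx
      have := abs_le.1 ((abs_rep_le_of_torusDist_le hcx).trans h2Φ₀)
      exact ⟨this.1, this.2⟩
    obtain ⟨hwt, hwn⟩ := tripleWindows_of_conservation (hD.periodic_u 0) (fun i => sectorCenter n' (ω i)) k d R hkd hsum θs hdt hdn
      hab hac hbc φ j hθ hval hφΦ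
    -- the context vector is `Q`
    have hQω : R - ∑ i ∈ Finset.univ \ {a, b, c}, fermiPoint u (sectorCenter n' (ω i)) - (3 : ℝ) • fermiPoint u θs = Q := by
      rw [hQ]
      congr 2
      refine Finset.sum_congr rfl fun i hi => ?_
      rw [Finset.mem_sdiff] at hi
      have hi' : i ≠ a ∧ i ≠ b ∧ i ≠ c := by simpa using hi.2
      rw [hoff ω hupd i hi'.1 hi'.2.1 hi'.2.2]
    rw [hQω] at hwt hwn
    show e ω ∈ (T : Set ((Fin (sectorCount n') × Fin (sectorCount n')) × Fin (sectorCount n')))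
    rw [Finset.mem_coe, hT, Finset.mem_filter]
    refine ⟨Finset.mem_univ _, hca, hcb, hcc, hwt, ?_⟩
    rw [sub_neg_eq_add]
    exact hwn
  have hcard : Fib.card ≤ T.card := Finset.card_le_card_of_injOn e hmaps hinj
  have h1 : (Fib.card : ℝ) ≤ (T.card : ℝ) := by exact_mod_cast hcard
  exact h1.trans hTcard

end Summit.HubbardSuperconductivity.HubbardSuperconductivity.Theorems.AbsUmklappCount

end
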